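import Mathlib.LinearAlgebra.Matrix.Determinant.Basic
import Mathlib.Tactic.LinearCombination
import Literature.LinearAlgebra.Matrix.PermanentSubperm
import HarnessLib

/-!
# Valiant's iff-coupling matrix `K` (Bürgisser 2024 survey, §2.7, Lemma 2.31 (eq. K-eq)) and
# Remark 2.32: the determinantal analogue of the system has no solution — PROVED

Topic `Computability/AlgebraicComplexity`. Cell `val-lit`, row Bur2024-A (Bürgisser 2024 survey
*Completeness classes in algebraic complexity theory*, arXiv:2406.06217), §2.7 "Completeness of
the permanent" (held text `paper:arxiv-2406.06217`, p0010 L138 – p0011 L36). In the proof sketch of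
Prop. 2.30 (Valiant: a Boolean sum of a size-`s` formula is a projection of `PER_{6s}`) the survey
inserts between two edges `c, c'` of a digraph the auxiliary digraph with weight matrix

  `K = ((-1, 1, 1/2), (1, 1, -1/2), (1, 1, -1/2))`  (p0011 L5–L8),

and states (Lemma 2.31, "iff-coupling": the permanent of the coupled digraph is the sum of the
weights of the cycle covers containing both or none of `c, c'`) that "the proof is a
straightforward verification based on

  (K-eq)  `per(K[2|1]) = per(K[2|3]) = per(K[3|1]) = per(K[3|3]) = 0`, `per(K) = per(K[2,3|1,3]) = 1`,

where `K[R|C]` denotes `K` with rows in `R` and columns in `C` removed" (p0011 L18–L25), and then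

> **Remark 2.32.** Looking for a matrix `K` satisfying (K-eq) leads to a system of polynomial
> equations. If the corresponding system with `per` replaced by `det`, had a complex solution,
> then an adaptation of the proof would show that `VP = VNP`. Of course, this system does not
> have a solution. (p0011 L27–L32)

This file checks (K-eq) for the printed `K` (`Bur24_iffCoupling_K_eq`; any field of
characteristic `≠ 2`, where `1/2` makes sense) and PROVES Remark 2.32's "of course" over every
commutative ring, through the identity
`K₁₂ · det K = det K[2|1] · det K[3|3] − det K[2|3] · det K[3|1]` for `3 × 3` matrices
(`Bur24_rem_2_32_identity`, a Desnanot–Jacobi-type expansion): the four vanishing minors force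
`K₁₂ · det K = 0`, while the last two equations ask for `det K = K₁₂ = 1`
(`Bur24_rem_2_32_det_eq_zero`, `Bur24_rem_2_32`). Indices: the survey's rows/columns `1, 2, 3` are
Lean's `0, 1, 2`; "remove row `r` / column `c`" is `submatrix (Fin.succAbove r) (Fin.succAbove c)`,
and `K[2,3|1,3]` is the `1 × 1` matrix `(K₁₂)` = entry `K 0 1`.

The tree already has Valiant's reduction with the `4 × 4` gadget of BCS 1997 / Bürgisser 2000
(`permanent_gadgetM`, `PermanentBooleanSum*.lean`, `PermanentCompleteness.lean`); the survey's
`3 × 3` matrix and Remark 2.32 were not in the tree (cell CHECK-t09-part3, row 2.32). Lemma 2.31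
itself (the cycle-cover statement) is not re-typed here. Theorems only; 0 definitions, 0 named
facts. Honest framing: a finite verification and a `3 × 3` determinant identity; nothing here bears
on `VP` versus `VNP`; `VP ≠ VNP` is NOT proved.

## References

* [Burgisser2024Completeness] P. Bürgisser, arXiv:2406.06217 (2024), §2.7: Lemma 2.31,
  eq. (K-eq), Remark 2.32 (p0011 L1–L36).
* [Valiant1979] L. G. Valiant, *Completeness classes in algebra*, STOC 1979 (the construction).
-/

namespace Literature.Computability.AlgebraicComplexity

open Matrix

/-! ## (K-eq) for the printed matrix -/

section Permanent

variable {F : Type*} [Field F]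

/-- **(K-eq) for Valiant's iff-coupling matrix** `K = ((-1, 1, 1/2), (1, 1, -1/2), (1, 1, -1/2))`
(Bürgisser 2024, Lemma 2.31), in characteristic `≠ 2`:
`per K[2|1] = per K[2|3] = per K[3|1] = per K[3|3] = 0`, `per K = 1`, `per K[2,3|1,3] = 1`
(rows/columns `1,2,3` of print = `0,1,2` here; `K[r|c]` = delete row `r` and column `c`).
[cite: Burgisser2024Completeness, Lemma 2.31 eq. (K-eq) (§2.7, p0011 L5–L25)] -/
theorem Bur24_iffCoupling_K_eq (h2 : (2 : F) ≠ 0) :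
    let K : Matrix (Fin 3) (Fin 3) F := !![-1, 1, 2⁻¹; 1, 1, -2⁻¹; 1, 1, -2⁻¹]
    (K.submatrix (Fin.succAbove 1) (Fin.succAbove 0)).permanent = 0 ∧
      (K.submatrix (Fin.succAbove 1) (Fin.succAbove 2)).permanent = 0 ∧
      (K.submatrix (Fin.succAbove 2) (Fin.succAbove 0)).permanent = 0 ∧
      (K.submatrix (Fin.succAbove 2) (Fin.succAbove 2)).permanent = 0 ∧
      K.permanent = 1 ∧
      (K.submatrix (fun _ : Fin 1 => (0 : Fin 3)) (fun _ : Fin 1 => (1 : Fin 3))).permanent = 1 := by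
  intro K
  have hinv : (2 : F)⁻¹ * 2 = 1 := inv_mul_cancel₀ h2
  refine ⟨?_, ?_, ?_, ?_, ?_, ?_⟩
  · rw [permanent_fin_two_row]
    simp [K, Fin.succAbove]
  · rw [permanent_fin_two_row]
    simp [K, Fin.succAbove]
  · rw [permanent_fin_two_row]
    simp [K, Fin.succAbove]
  · rw [permanent_fin_two_row]
    simp [K, Fin.succAbove]
  · rw [permanent_fin_three_row]
    simp [K]
    linear_combination hinv
  · rw [permanent_unique]
    simp [K]

end Permanent

/-! ## Remark 2.32: the determinantal system has no solution -/

section Determinant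

variable {R : Type*} [CommRing R]

/-- **The `3 × 3` identity behind Remark 2.32**: for every `3 × 3` matrix `K` over a commutative
ring, `K₁₂ · det K = det K[2|1] · det K[3|3] − det K[2|3] · det K[3|1]` (a Desnanot–Jacobi-type
expansion; rows/columns `1,2,3` of print = `0,1,2` here).
[cite: Burgisser2024Completeness, Remark 2.32 (§2.7, p0011 L27–L32)] -/
theorem Bur24_rem_2_32_identity (K : Matrix (Fin 3) (Fin 3) R) :
    K 0 1 * K.det =
      (K.submatrix (Fin.succAbove 1) (Fin.succAbove 0)).det *
          (K.submatrix (Fin.succAbove 2) (Fin.succAbove 2)).det -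
        (K.submatrix (Fin.succAbove 1) (Fin.succAbove 2)).det *
          (K.submatrix (Fin.succAbove 2) (Fin.succAbove 0)).det := by
  rw [det_fin_three, det_fin_two, det_fin_two, det_fin_two, det_fin_two]
  simp [Fin.succAbove]
  ring

/-- **Remark 2.32, quantitative form**: if the four minors of (K-eq) vanish for `det`, then
`K₁₂ · det K = 0`. [cite: Burgisser2024Completeness, Remark 2.32 (§2.7, p0011 L27–L32)] -/
theorem Bur24_rem_2_32_det_eq_zero (K : Matrix (Fin 3) (Fin 3) R)
    (h21 : (K.submatrix (Fin.succAbove 1) (Fin.succAbove 0)).det = 0)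
    (h23 : (K.submatrix (Fin.succAbove 1) (Fin.succAbove 2)).det = 0)
    (h31 : (K.submatrix (Fin.succAbove 2) (Fin.succAbove 0)).det = 0)
    (h33 : (K.submatrix (Fin.succAbove 2) (Fin.succAbove 2)).det = 0) :
    K 0 1 * K.det = 0 := by
  rw [Bur24_rem_2_32_identity, h21, h23, h31, h33]
  ring

/-- **Bürgisser 2024, Remark 2.32 — "of course, this system does not have a solution"**: over
every commutative ring with `0 ≠ 1`, NO `3 × 3` matrix `K` satisfies the determinantal analogue
of (K-eq), `det K[2|1] = det K[2|3] = det K[3|1] = det K[3|3] = 0` and `det K = det K[2,3|1,3] = 1`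
(the last minor is the entry `K₁₂`): the four vanishing minors force `K₁₂ · det K = 0`.
[cite: Burgisser2024Completeness, Remark 2.32 (§2.7, p0011 L27–L32)] -/
theorem Bur24_rem_2_32 [Nontrivial R] :
    ¬ ∃ K : Matrix (Fin 3) (Fin 3) R,
      (K.submatrix (Fin.succAbove 1) (Fin.succAbove 0)).det = 0 ∧
        (K.submatrix (Fin.succAbove 1) (Fin.succAbove 2)).det = 0 ∧
        (K.submatrix (Fin.succAbove 2) (Fin.succAbove 0)).det = 0 ∧
        (K.submatrix (Fin.succAbove 2) (Fin.succAbove 2)).det = 0 ∧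
        K.det = 1 ∧
        (K.submatrix (fun _ : Fin 1 => (0 : Fin 3)) (fun _ : Fin 1 => (1 : Fin 3))).det = 1 := by
  rintro ⟨K, h21, h23, h31, h33, hdet, h1⟩
  have h01 : K 0 1 = 1 := by
    rw [det_unique] at h1
    simpa using h1
  have h := Bur24_rem_2_32_det_eq_zero K h21 h23 h31 h33
  rw [h01, hdet, one_mul] at h
  exact one_ne_zero h

end Determinant

end Literature.Computability.AlgebraicComplexity
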